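import Mathlib
import Literature.MathematicalPhysics.QuantumFieldTheory.Balaban1983to89.B8Eq194CriterionCurved
import Literature.MathematicalPhysics.QuantumFieldTheory.Balaban1983to89.B8Eq194CriterionFibre

/-!
# G-B8-19 (c) with BOUNDARY / LOCAL TERMS: the criterion Q′ΔN(Q′) = 0 behind «(1.91)'s H′ = [4]'s H′ (3.163)» fails
# at every background for Δ_U + P, P ANY site-local term — in particular for [4]'s Dirichlet boundary conditions

statement-level skeleton of published theorems with citation tags; proofs where landed; nothing here is a claim
about the Yang–Mills mass gap

Seat p40 gen 10, Phase 2 (free target B; owner r05 row B8.Eq1.91; closes HONEST SCOPE (ii)/(iv) of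
`B8Eq194CriterionCurved` «[4]'s Dirichlet b.c. at curved backgrounds not instantiated»).  Sources:
[Balaban1985RegularSpaces] T. Bałaban, *Spaces of regular gauge field configurations on a lattice and gauge fixing
conditions*, CMP 99 (1985) 75–102: (1.91) p. 91 [PDF 17] «H′ = G′²Q′\*(Q′G′²Q′\*)⁻¹, G′ = (Δ + Q′\*aQ′)⁻¹»;
[Balaban1985BackgroundPropagators] T. Bałaban, *Propagators for lattice gauge theories in a background field*, CMP 99
(1985) 389–434: (3.3) p. 391, (3.19) p. 393, (3.23) p. 394 — verbatim (page image `…-p006-x2.png`; v1.0.2 replaces the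
v1.0 condensed paraphrase that stood inside guillemets here, referee notes ref-1 g49 F4-NIT / ref-4 g34 S-B8-g34-1): «In the
above formulas Δ_U is the covariant Laplce [sic] operator Δ^η_U = D^{η\*}_U D^η_U = Σ_{μ=1}^d D^{η\*}_{U,μ}D^η_{U,μ}. (3.23)»,
«The operator Δ^η_U↾Ω₀ is the covariant Laplace operator with Dirichlet boundary conditions on Ω₀^c.», «Let us
introduce a domain Ω₀ such that Ω₁ ⊂ Ω₀ and Ω₀ is a union of big blocks of the lattice T₁», «For such Ω₀ we consider
the operator Δ′_a with Dirichlet boundary conditions on ∂Ω₀, i.e. the operator Δ′_a↾Ω₀ = Ω₀Δ′_aΩ₀.» —, (3.24)–(3.25)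
p. 394, Thm 3.11 p. 416, (3.162)–(3.165) p. 429; [Balaban1985Averaging] (2) p. 17.

WHY THIS FILE.  Part D (`B8Eq194CriterionCurved`) proved that on the free box with K ≥ 2 cubes of side L ≥ 2 per axis
the criterion fails at EVERY background — for the operator Δ_U = D†D assembled from the bonds INSIDE the carrier (free
boundary condition; on the torus: periodic).  [4] (3.23) takes Δ^η_U with DIRICHLET boundary conditions on Ω₀^c: for
λ supported in Ω₀ and extended by 0, every bond b leaving Ω₀ contributes c_b|λ(b∩Ω₀)|² to ⟨λ, Δλ⟩, i.e. the Dirichlet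
operator on L²(Ω₀, 𝔤) is (D†D over the interior bonds) + diag(m), m(x) = Σ_{b ∋ x leaving Ω₀} c_b ≥ 0 (part 3,
`B8Eq194CriterionDirichlet`, classified this in the flat scalar model: criterion ⟺ L = 1 ∨ (L, K) = (2, 1)).  Here the
every-background theorem is re-proved for Δ_U + P with P ANY linear term that is LOCAL AT THE SITES ((Pf)(x) = 0
whenever f(x) = 0): the two-site test function λ = δ_{x₁}v₁ + δ_{x₂}v₂ of part D vanishes at the site x₀ where
(Q′Δλ)(c) is read off and on all of B(c), so the local term never enters.  Dirichlet masses, pointwise potentials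
and P = 0 are all covered; the (3.25)-data for Δ_U + diag(m), m ≥ 0, exist at every background by [4] Thm 3.11
«obvious» (`B9Thm311Data.data_of_posDef`).

CONTENT.
§1 **`not_criterion_of_adjacent_blocks_local`** (part D's abstract theorem with Δ_U ↦ Δ_U + P, P site-local),
   **`exists_Hp_ne_H4_of_adjacent_blocks_local`** (any (3.25)-data over (Δ_U + P, Q′, Q′\*, a) with a onto);
   `criterion_of_subsingleton_blocks_any` / `H4_eq_Hp_of_subsingleton_blocks_any` (L = 1: N(Q′) = 0, so the criterion
   holds for EVERY operator in place of Δ).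
§2 THE DATA WITH A NONNEGATIVE DIAGONAL TERM: `AL_local` (diag(m) is site-local), `inner_add_AL_symm`,
   `inner_AL_self_nonneg`, **`lapA_add_AL_posDef`** (Δ′_a + diag(m) > 0), **`data_add_AL`** (G′ = (Δ_U + diag m +
   Q′\*aQ′)⁻¹ and (Q′G′²Q′\*)⁻¹ are (3.25)-data — every background, every block system, every m ≥ 0),
   `exists_data_add_AL`.
§3 (companion file `B8Eq194CriterionLocalTermsBox`, ≤ 400-line rule): THE FREE BOX {0, …, LK − 1}^d (K ≥ 2 cubes of
   side L ≥ 2 per axis, every d ≥ 1), EVERY background AND every site-local term — `not_criterion_box_local`,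
   `Hp_ne_H4_box_local`, hypothesis-free `exists_data_Hp_ne_H4_box_add_AL` (printed cubes, ANY m ≥ 0).

NET.  On the free box with K ≥ 2 cubes per axis, «(1.91)'s H′ = [4]'s H′ (3.163)» FAILS for L ≥ 2 at every background
under free, periodic (part D) AND Dirichlet (this file) boundary conditions alike, and HOLDS for L = 1 whatever the
operator: the discrepancy recorded in G-B8-19 does not depend on the boundary condition chosen for Δ^η_U.

HONEST SCOPE.  (i) «Dirichlet» is modelled on the carrier X = Ω₀ as interior bonds + a nonnegative diagonal term
(dictionary above); the restriction-from-a-larger-lattice is not typed.  (ii) The failure theorems allow ANY linear P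
with (Pf)(x) = 0 ⇐ f(x) = 0 (no sign, no symmetry); the data existence needs P = diag(m), m ≥ 0 (symmetric,
nonnegative).  (iii) K = 1 and the torus are not treated here (part D §5 / `B8Eq194CriterionTorus22Defect`).  No bound,
no row head changes; value = boundary-condition independence of the cell's located reading G-B8-19 (c), NOT summit
progress.
-/

namespace Literature.MathematicalPhysics.QuantumFieldTheory.Balaban1983to89.B8Eq194CriterionLocalTerms

open Finset
open Literature.MathematicalPhysics.QuantumFieldTheory.Balaban1983to89.B9Eq323Ker
  Literature.MathematicalPhysics.QuantumFieldTheory.Balaban1983to89.B9Thm311Lattice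
  Literature.MathematicalPhysics.QuantumFieldTheory.Balaban1983to89.B9Thm311Data
  Literature.MathematicalPhysics.QuantumFieldTheory.Balaban1983to89.B9Eq325Proj
  Literature.MathematicalPhysics.QuantumFieldTheory.Balaban1983to89.B8Eq191Hprime
  Literature.MathematicalPhysics.QuantumFieldTheory.Balaban1983to89.B8Eq194FirstTerm
  Literature.MathematicalPhysics.QuantumFieldTheory.Balaban1983to89.B8Eq194Criterion
  Literature.MathematicalPhysics.QuantumFieldTheory.Balaban1983to89.B8Eq194CriterionLattice
  Literature.MathematicalPhysics.QuantumFieldTheory.Balaban1983to89.B8Eq194CriterionCarriers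
  Literature.MathematicalPhysics.QuantumFieldTheory.Balaban1983to89.B8Eq194CriterionCarriersWitness
  Literature.MathematicalPhysics.QuantumFieldTheory.Balaban1983to89.B8Eq194CriterionCurved
  Literature.MathematicalPhysics.QuantumFieldTheory.Balaban1983to89.B8Eq194CriterionFibre
open scoped InnerProductSpace

/-! ## §1  Two adjacent blocks, one far site ⟹ the criterion fails for Δ_U + P, P any site-local term -/

section Abstract

variable {X : Type*} {Y : Type*} {V : Type*} [NormedAddCommGroup V] [InnerProductSpace ℝ V]
variable [Fintype X] [DecidableEq X] [FiniteDimensional ℝ V]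
variable (τ : X → X → V →ₗ[ℝ] V) {bonds : Finset (X × X)} (cb : X × X → ℝ) (w : Y → X → ℝ) (B : Y → Finset X)
  (Γ : Y → X → List X) (y : Y → X)

/-- **Q′(Δ + P)N(Q′) ≠ 0 at EVERY background, for every SITE-LOCAL term P** ((Pf)(x) = 0 whenever f(x) = 0: the
Dirichlet boundary masses of (3.23), a pointwise potential, P = 0).  Geometry as in part D: blocks c ≠ c′, x₀ ∈ B(c),
x₁ ≠ x₂ ∈ B(c′) only, w(c,x₀), w(c′,x₂) ≠ 0, ⟨x₀,x₁⟩ a bond (either orientation), x₀ the only site of B(c) bonded to x₁,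
no site of B(c) bonded to x₂; injective transports, positive bond weights, any contours and centres.  The test function
λ = δ_{x₁}v₁ + δ_{x₂}v₂ ∈ N(Q′) vanishes on B(c), so ((Δ + P)λ)(x) = (Δλ)(x) there and part D's reading of the charge at
x₁ from (Q′(Δ + P)λ)(c) = 0 goes through verbatim. [cite: Balaban1985BackgroundPropagators, (3.19) p. 393, (3.23)
p. 394, (3.162)–(3.165) p. 429; Balaban1985RegularSpaces, (1.91) p. 91] -/
theorem not_criterion_of_adjacent_blocks_local [Nontrivial V] (hinj : ∀ x x' : X, Function.Injective (τ x x'))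
    (hcb : ∀ b ∈ bonds, 0 < cb b) (P : PiLp 2 (fun _ : X => V) →ₗ[ℝ] PiLp 2 (fun _ : X => V))
    (hP : ∀ (f : PiLp 2 (fun _ : X => V)) (x : X), f x = 0 → P f x = 0)
    {c c' : Y} {x₀ x₁ x₂ : X} (hc : c ≠ c') (hx₀ : x₀ ∈ B c) (hx₁ : x₁ ∈ B c')
    (hx₂ : x₂ ∈ B c') (h12 : x₁ ≠ x₂) (honly₁ : ∀ c'', x₁ ∈ B c'' → c'' = c')
    (honly₂ : ∀ c'', x₂ ∈ B c'' → c'' = c') (hw₀ : w c x₀ ≠ 0) (hw₂ : w c' x₂ ≠ 0)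
    (hadj : (x₀, x₁) ∈ bonds ∨ (x₁, x₀) ∈ bonds)
    (hcompat : (x₀, x₁) ∈ bonds → (x₁, x₀) ∈ bonds → ∀ u v : V, ⟪τ x₀ x₁ u, v⟫_ℝ = ⟪u, τ x₁ x₀ v⟫_ℝ)
    (huniq : ∀ x ∈ B c, ((x, x₁) ∈ bonds ∨ (x₁, x) ∈ bonds) → x = x₀)
    (hfar : ∀ x ∈ B c, (x, x₂) ∉ bonds ∧ (x₂, x) ∉ bonds) :
    ¬ ∀ f : PiLp 2 (fun _ : X => V), qL τ w B Γ y f = 0 → qL τ w B Γ y ((lapL τ bonds cb + P) f) = 0 := by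
  intro hcrit
  have hcb0 : ∀ b ∈ bonds, 0 ≤ cb b := fun b hb => (hcb b hb).le
  have hx₁c : x₁ ∉ B c := fun h => hc (honly₁ c h)
  have hx₂c : x₂ ∉ B c := fun h => hc (honly₂ c h)
  have h01 : x₀ ≠ x₁ := fun h => hx₁c (h ▸ hx₀)
  have h02 : x₀ ≠ x₂ := fun h => hx₂c (h ▸ hx₀)
  obtain ⟨v₁, hv₁⟩ := exists_ne (0 : V)
  have hsurj₂ : Function.Surjective (pathTr τ (y c' :: Γ c' x₂)) :=
    LinearMap.injective_iff_surjective.mp (pathTr_injective hinj _)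
  obtain ⟨v₂, hv₂⟩ := hsurj₂ ((w c' x₂)⁻¹ • -(w c' x₁ • pathTr τ (y c' :: Γ c' x₁) v₁))
  set f : PiLp 2 (fun _ : X => V) := single x₁ v₁ + single x₂ v₂ with hf
  have hfx : ∀ x, f x = (if x = x₁ then v₁ else 0) + (if x = x₂ then v₂ else 0) := fun x => by
    rw [hf, PiLp.add_apply, single_apply, single_apply]
  have hf1 : f x₁ = v₁ := by rw [hfx, if_pos rfl, if_neg h12, add_zero]
  have hf0 : ∀ x, x ≠ x₁ → x ≠ x₂ → f x = 0 := fun x h1 h2 => by rw [hfx, if_neg h1, if_neg h2, add_zero]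
  -- the local term vanishes on B(c), where λ does
  have hPc : ∀ x ∈ B c, P f x = 0 :=
    fun x hx => hP f x (hf0 x (fun h => hx₁c (h ▸ hx)) (fun h => hx₂c (h ▸ hx)))
  have hsum : ∀ x, (lapL τ bonds cb + P) f x = lapL τ bonds cb f x + P f x := fun x => by
    rw [LinearMap.add_apply, PiLp.add_apply]
  -- λ ∈ N(Q′)
  have hq : qL τ w B Γ y f = 0 := by
    ext c''
    rw [hf, map_add, PiLp.add_apply, qL_single, qL_single, PiLp.zero_apply]
    by_cases hc'' : c'' = c'
    · subst hc''
      rw [if_pos hx₁, if_pos hx₂, hv₂, smul_smul, mul_inv_cancel₀ hw₂, one_smul, add_neg_cancel]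
    · rw [if_neg (fun h => hc'' (honly₁ _ h)), if_neg (fun h => hc'' (honly₂ _ h)), add_zero]
  -- (Δ + P)λ vanishes on B(c) away from x₀ …
  have hzero : ∀ x ∈ B c, x ≠ x₀ → (lapL τ bonds cb + P) f x = 0 := by
    intro x hx hne
    rw [hsum, hPc x hx, add_zero]
    refine lapL_apply_eq_zero τ bonds cb hcb0 f x
      (hf0 x (fun h => hx₁c (h ▸ hx)) (fun h => hx₂c (h ▸ hx))) fun z hz => hf0 z ?_ ?_
    · rintro rfl
      exact hne (huniq x hx hz)
    · rintro rfl
      exact (hz.elim (hfar x hx).1 (hfar x hx).2).elim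
  -- … so (Q′(Δ + P)λ)(c) = w(c,x₀)·R(U(Γ))(Δλ)(x₀), which the criterion makes 0
  have hval : lapL τ bonds cb f x₀ = 0 := by
    have h1 := congrArg (fun φ : PiLp 2 (fun _ : Y => V) => φ c) (hcrit f hq)
    simp only [PiLp.zero_apply] at h1
    rw [qL_apply] at h1
    unfold avgQ at h1
    rw [Finset.sum_eq_single_of_mem x₀ hx₀ fun x hx hne => by
      rw [show WithLp.ofLp ((lapL τ bonds cb + P) f) x = (lapL τ bonds cb + P) f x from rfl, hzero x hx hne,
        map_zero, smul_zero]] at h1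
    rcases smul_eq_zero.mp h1 with h2 | h2
    · exact absurd h2 hw₀
    · have h3 : (lapL τ bonds cb + P) f x₀ = 0 := pathTr_injective hinj _ (by rw [map_zero]; exact h2)
      rwa [hsum, hPc x₀ hx₀, add_zero] at h3
  -- read off the charge at x₁ from (Δλ)(x₀) = 0
  have hnear := inner_lapL_apply_near τ bonds cb hcb0 f (Ne.symm h01) (hf0 x₀ h01 h02)
    (fun z hz1 hz => hf0 z hz1 (by rintro rfl; exact hz.elim (hfar x₀ hx₀).1 (hfar x₀ hx₀).2))
  have hzero₁ : f x₁ = 0 :=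
    eq_zero_of_near τ hcb hadj hcompat (hinj x₀ x₁) (LinearMap.injective_iff_surjective.mp (hinj x₁ x₀)) (f x₁)
      fun v => by
        have h := hnear v
        rw [hval, inner_zero_left] at h
        linarith
  rw [hf1] at hzero₁
  exact hv₁ hzero₁

/-- **Hence (1.91)'s H′ ≠ [4]'s H′ of (3.163) at every such background, for any (3.25)-data over (Δ_U + P, Q′(U),
Q′(U)\*, a) with a onto** — P any site-local term (e.g. [4]'s Dirichlet boundary masses).
[cite: Balaban1985RegularSpaces, (1.91) p. 91; Balaban1985BackgroundPropagators, (3.23)–(3.25) p. 394,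
(3.163)–(3.165) p. 429] -/
theorem exists_Hp_ne_H4_of_adjacent_blocks_local [Fintype Y] [Nontrivial V]
    (hinj : ∀ x x' : X, Function.Injective (τ x x')) (hcb : ∀ b ∈ bonds, 0 < cb b)
    (P : PiLp 2 (fun _ : X => V) →ₗ[ℝ] PiLp 2 (fun _ : X => V))
    (hP : ∀ (f : PiLp 2 (fun _ : X => V)) (x : X), f x = 0 → P f x = 0) {c c' : Y} {x₀ x₁ x₂ : X}
    (hc : c ≠ c') (hx₀ : x₀ ∈ B c) (hx₁ : x₁ ∈ B c') (hx₂ : x₂ ∈ B c') (h12 : x₁ ≠ x₂)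
    (honly₁ : ∀ c'', x₁ ∈ B c'' → c'' = c') (honly₂ : ∀ c'', x₂ ∈ B c'' → c'' = c') (hw₀ : w c x₀ ≠ 0)
    (hw₂ : w c' x₂ ≠ 0) (hadj : (x₀, x₁) ∈ bonds ∨ (x₁, x₀) ∈ bonds)
    (hcompat : (x₀, x₁) ∈ bonds → (x₁, x₀) ∈ bonds → ∀ u v : V, ⟪τ x₀ x₁ u, v⟫_ℝ = ⟪u, τ x₁ x₀ v⟫_ℝ)
    (huniq : ∀ x ∈ B c, ((x, x₁) ∈ bonds ∨ (x₁, x) ∈ bonds) → x = x₀)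
    (hfar : ∀ x ∈ B c, (x, x₂) ∉ bonds ∧ (x₂, x) ∉ bonds)
    {A : PiLp 2 (fun _ : Y => V) →ₗ[ℝ] PiLp 2 (fun _ : Y => V)}
    {g : PiLp 2 (fun _ : X => V) →ₗ[ℝ] PiLp 2 (fun _ : X => V)}
    {cc : PiLp 2 (fun _ : Y => V) →ₗ[ℝ] PiLp 2 (fun _ : Y => V)}
    (hdata : Data (lapL τ bonds cb + P) (qL τ w B Γ y) (LinearMap.adjoint (qL τ w B Γ y)) A g cc)
    (hA : Function.Surjective A) :
    ∃ μ, Hp (LinearMap.adjoint (qL τ w B Γ y)) g cc μ ≠ H4 (qL τ w B Γ y) (LinearMap.adjoint (qL τ w B Γ y)) A g cc μ := by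
  by_contra hall
  refine not_criterion_of_adjacent_blocks_local τ cb w B Γ y hinj hcb P hP hc hx₀ hx₁ hx₂ h12 honly₁ honly₂ hw₀ hw₂
    hadj hcompat huniq hfar (criterion_of_H4_eq_Hp hdata hA fun μ => ?_)
  by_contra hμ
  exact hall ⟨μ, fun e => hμ e.symm⟩

omit [DecidableEq X] [Fintype X] [FiniteDimensional ℝ V] in
/-- **One-site blocks (L = 1): the criterion holds for EVERY operator in place of Δ** (N(Q′) = 0 at every
background), in particular for Δ_U + Dirichlet masses. [cite: Balaban1985BackgroundPropagators, (3.19) p. 393, (3.23)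
p. 394; Balaban1985RegularSpaces, (1.91) p. 91] -/
theorem criterion_of_subsingleton_blocks_any (hinj : ∀ x x' : X, Function.Injective (τ x x'))
    (hsub : ∀ c, ∀ x ∈ B c, ∀ x' ∈ B c, x = x') (hcover : ∀ x, ∃ c, x ∈ B c)
    (hw : ∀ c, ∀ x ∈ B c, w c x ≠ 0) (T : PiLp 2 (fun _ : X => V) →ₗ[ℝ] PiLp 2 (fun _ : X => V)) :
    ∀ f : PiLp 2 (fun _ : X => V), qL τ w B Γ y f = 0 → qL τ w B Γ y (T f) = 0 := by
  intro f hf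
  rw [eq_zero_of_qL_eq_zero_of_subsingleton τ w B Γ y hinj hsub hcover hw f hf, map_zero, map_zero]

omit [DecidableEq X] in
/-- **One-site blocks: (1.91)'s H′ = [4]'s H′ for every background, every operator in place of Δ_U and every
(3.25)-data over it.** [cite: Balaban1985RegularSpaces, (1.91) p. 91; Balaban1985BackgroundPropagators,
(3.163)–(3.165) p. 429] -/
theorem H4_eq_Hp_of_subsingleton_blocks_any [Fintype Y] (hinj : ∀ x x' : X, Function.Injective (τ x x'))
    (hsub : ∀ c, ∀ x ∈ B c, ∀ x' ∈ B c, x = x') (hcover : ∀ x, ∃ c, x ∈ B c)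
    (hw : ∀ c, ∀ x ∈ B c, w c x ≠ 0) (T : PiLp 2 (fun _ : X => V) →ₗ[ℝ] PiLp 2 (fun _ : X => V))
    {A : PiLp 2 (fun _ : Y => V) →ₗ[ℝ] PiLp 2 (fun _ : Y => V)}
    {g : PiLp 2 (fun _ : X => V) →ₗ[ℝ] PiLp 2 (fun _ : X => V)}
    {cc : PiLp 2 (fun _ : Y => V) →ₗ[ℝ] PiLp 2 (fun _ : Y => V)}
    (hdata : Data T (qL τ w B Γ y) (LinearMap.adjoint (qL τ w B Γ y)) A g cc) (μ : PiLp 2 (fun _ : Y => V)) :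
    H4 (qL τ w B Γ y) (LinearMap.adjoint (qL τ w B Γ y)) A g cc μ = Hp (LinearMap.adjoint (qL τ w B Γ y)) g cc μ :=
  H4_eq_Hp_of_criterion hdata (criterion_of_subsingleton_blocks_any τ w B Γ y hinj hsub hcover hw T) μ

end Abstract

/-! ## §2  The (3.25)-data for Δ_U + diag(m), m ≥ 0 (Dirichlet masses), at every background -/

section DataAddDiag

variable {X : Type*} {Y : Type*} {V : Type*} [NormedAddCommGroup V] [InnerProductSpace ℝ V]
variable [Fintype X] [Fintype Y] [FiniteDimensional ℝ V]
variable (τ : X → X → V →ₗ[ℝ] V) {bonds : Finset (X × X)} (cb : X × X → ℝ) {w : Y → X → ℝ} {B : Y → Finset X}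
  {Γ : Y → X → List X} {y : Y → X} (m : X → ℝ) (a : Y → ℝ)

omit [Fintype X] [Fintype Y] [FiniteDimensional ℝ V] in
/-- diag(m) is a site-local term: (diag(m) f)(x) = m(x)·f(x). [cite: Balaban1985BackgroundPropagators, (3.23) p. 394] -/
theorem AL_local (f : PiLp 2 (fun _ : X => V)) (x : X) (hx : f x = 0) : AL (V := V) m f x = 0 := by
  rw [AL_apply]
  show m x • f x = 0
  rw [hx, smul_zero]

omit [Fintype Y] in
/-- Δ_U + diag(m) is symmetric. [cite: Balaban1985BackgroundPropagators, (3.23) p. 394] -/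
theorem inner_add_AL_symm (f f' : PiLp 2 (fun _ : X => V)) :
    ⟪(lapL τ bonds cb + AL (V := V) m) f, f'⟫_ℝ = ⟪f, (lapL τ bonds cb + AL (V := V) m) f'⟫_ℝ := by
  rw [LinearMap.add_apply, LinearMap.add_apply, inner_add_left, inner_add_right, lapL_symm, AL_symm]

omit [Fintype Y] [FiniteDimensional ℝ V] in
/-- ⟨f, diag(m) f⟩ ≥ 0 for m ≥ 0. [cite: Balaban1985BackgroundPropagators, (3.23) p. 394] -/
theorem inner_AL_self_nonneg (hm : ∀ x, 0 ≤ m x) (f : PiLp 2 (fun _ : X => V)) : 0 ≤ ⟪f, AL m f⟫_ℝ := by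
  rw [inner_AL_self]
  exact Finset.sum_nonneg fun x _ => mul_nonneg (hm x) (sq_nonneg _)

/-- **Δ′_a + diag(m) = (Δ_U + diag m) + Q′\*aQ′ > 0** on the lattice carriers (m ≥ 0, a_c > 0, every background with
injective transports, positive bond weights, every block system). [cite: Balaban1985BackgroundPropagators,
Thm 3.11 p. 416, (3.23)–(3.24) p. 394] -/
theorem lapA_add_AL_posDef (hinj : ∀ x x' : X, Function.Injective (τ x x')) (hcb : ∀ b ∈ bonds, 0 < cb b)
    (hS : IsBlockSystem bonds w B Γ y) (hm : ∀ x, 0 ≤ m x) (ha : ∀ c, 0 < a c) :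
    PosDef (lapA (lapL τ bonds cb + AL (V := V) m) (qL τ w B Γ y) (LinearMap.adjoint (qL τ w B Γ y)) (AL a)) := by
  intro f hf
  have h1 := lapA_lattice_posDef τ hinj cb hcb hS a ha f hf
  have h2 := inner_AL_self_nonneg m hm f
  have e : lapA (lapL τ bonds cb + AL (V := V) m) (qL τ w B Γ y) (LinearMap.adjoint (qL τ w B Γ y)) (AL a) f
      = lapA (lapL τ bonds cb) (qL τ w B Γ y) (LinearMap.adjoint (qL τ w B Γ y)) (AL a) f + AL m f := by
    rw [lapA_apply, lapA_apply, LinearMap.add_apply]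
    abel
  rw [e, inner_add_right]
  exact add_pos_of_pos_of_nonneg h1 h2

/-- **The (3.25)-data EXIST for Δ_U + diag(m)** (m ≥ 0): G′ = ((Δ_U + diag m) + Q′\*aQ′)⁻¹ and (Q′G′²Q′\*)⁻¹, constructed
by `B9Thm311Data.gOf`/`cOf` ([4] Thm 3.11 «obvious for the first three operators», finite dimension), are `Data` — for
every background, block system, a_c > 0; in particular for [4]'s Dirichlet operator of (3.23).
[cite: Balaban1985BackgroundPropagators, Thm 3.11 p. 416, (3.23)–(3.25) p. 394] -/
theorem data_add_AL (hinj : ∀ x x' : X, Function.Injective (τ x x')) (hcb : ∀ b ∈ bonds, 0 < cb b)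
    (hS : IsBlockSystem bonds w B Γ y) (hm : ∀ x, 0 ≤ m x) (ha : ∀ c, 0 < a c) :
    Data (lapL τ bonds cb + AL (V := V) m) (qL τ w B Γ y) (LinearMap.adjoint (qL τ w B Γ y)) (AL a)
      (gOf (lapL τ bonds cb + AL (V := V) m) (qL τ w B Γ y) (LinearMap.adjoint (qL τ w B Γ y)) (AL a)
        (lapA_add_AL_posDef τ cb m a hinj hcb hS hm ha))
      (cOf (lapA_add_AL_posDef τ cb m a hinj hcb hS hm ha) (inner_add_AL_symm τ cb m)
        (qL_adjoint_pair τ w B Γ y) (AL_symm a) (adjoint_qL_injective τ hS)) :=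
  data_of_posDef _ _ _ _ _

/-- Existential form of `data_add_AL`. [cite: Balaban1985BackgroundPropagators, Thm 3.11 p. 416, (3.23)–(3.25) p. 394] -/
theorem exists_data_add_AL (hinj : ∀ x x' : X, Function.Injective (τ x x')) (hcb : ∀ b ∈ bonds, 0 < cb b)
    (hS : IsBlockSystem bonds w B Γ y) (hm : ∀ x, 0 ≤ m x) (ha : ∀ c, 0 < a c) :
    ∃ (g : PiLp 2 (fun _ : X => V) →ₗ[ℝ] PiLp 2 (fun _ : X => V))
      (cc : PiLp 2 (fun _ : Y => V) →ₗ[ℝ] PiLp 2 (fun _ : Y => V)),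
      Data (lapL τ bonds cb + AL (V := V) m) (qL τ w B Γ y) (LinearMap.adjoint (qL τ w B Γ y)) (AL a) g cc :=
  ⟨_, _, data_add_AL τ cb m a hinj hcb hS hm ha⟩

end DataAddDiag

end Literature.MathematicalPhysics.QuantumFieldTheory.Balaban1983to89.B8Eq194CriterionLocalTerms
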